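import Mathlib
import Summits.Ventures.HodgeRepro.Tier4.Common.AdelicDefs
import Summits.Ventures.HodgeRepro.Tier4.Common.AdelicRTF
import Summits.Ventures.HodgeRepro.Tier4.Common.AdelicPlaces
import Summits.Ventures.HodgeRepro.Tier4.Common.MixedPlane

/-!
# Tier4/Common/LocalTorus — vocabulary for the wall census of LINE L4 (t4-plan-4 S12873, «VOCABULARY ASKS (typer-2)
(i) (ii)»): the local tori at the FINITE places, local characters, toric functionals on a subspace of automorphic
functions, a sign datum with its global sign, and the Hecke eigenvalue of the right regular action

Blind re-derivation cell `pub-hodge-repro`, Tier 4 (README §9–§10), seat t4-typer-2 (gen 2).  Target tree path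
`lean/Summits/Ventures/HodgeRepro/Tier4/Common/LocalTorus.lean`.  Imports `AdelicDefs` (`GA`, `torusT`, `torusT'`),
`AdelicRTF` (`rightRegular`, `IsTestFn`), `AdelicPlaces` (`GA.finiteComponent`, `GA.infiniteComponent`,
`LeftInvariantUnder`, `RightInvariantUnder`), `MixedPlane` (`restrictTo`).

(i) THE HECKE SIDE.  `rightRegular W μ f φ x = ∫ f(y) φ(x y) dμ(y)` (AdelicRTF) IS the operator `R(f)`; here:
`IsHeckeTestFn K f` (a test function bi-invariant under `K`), **`IsHeckeEigenvalue μ f V lam`** («`R(f)` acts on `V` by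
the scalar `lam = λ_V(f)`»), the shape W4's spectral side `J(f) = ∑_V λ_V(f) · P_T(v′_V)` is written in.

(ii) THE LOCAL SIDE.  `atFinitePlace W v` mirrors MixedPlaneKType's `atPlace W w` at a FINITE place `v` (all other
components trivial); `localTorusAtFinite W v = torusT W ⊓ atFinitePlace W v` is `T(k_v)` embedded at `v`, the local
character of `χ` is its restriction (`localChar`); **`IsToricFunctional S χ V ℓ`** («`ℓ ∈ Hom_S(V, χ)`: `ℓ(R(t) f) =
χ(t) ℓ(f)` for `f ∈ V`, `t ∈ S`», on the ambient function space with junk outside `V`) and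
**`HasNonzeroToricFunctional S χ V`** — with `S = localTorusAtFinite W v` this is «`Hom_{T_v}(V, χ_v) ≠ 0`», the left
side of Tunnell–Saito; **`LocalSignData k`** (a sign `±1` at every place, almost all `+1`) with `globalSign` and
`IsPlus` — the shape of W7's displayed condition `∏_v ε_v = +1`.  NOTHING here ties a `LocalSignData` to the
characters: that tie (Tunnell–Saito's `ε(½, π_v ⊗ χ_v) χ_v(−1)`, the `U(1) × U(1)` theta dichotomy) is a PRINTED
statement a lit seat types as a Prop over this vocabulary (W-L4-3); a free `LocalSignData` carries no content, exactly
as crit-1's junk test demands of a displayed hypothesis.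

Nothing here says anything about the status of the Hodge conjecture for CM abelian varieties, which is NOT proved
(HC_CM is NOT proved by anyone in this repository).
-/

set_option autoImplicit false

noncomputable section

namespace Summit.Ventures.HodgeRepro.Tier4.Common

open NumberField Matrix IsDedekindDomain MeasureTheory
open scoped NumberField

section FinitePlace

variable {k : Type} [Field k] [NumberField k] (W : PlaneData k)

/-- `g ∈ G(𝔸_k)` is supported at the finite place `v`: its components at every other finite place and at every
infinite place are trivial. -/
def IsAtFinitePlace (v : HeightOneSpectrum (𝓞 k)) (g : GA W) : Prop :=
  (∀ v' : HeightOneSpectrum (𝓞 k), v' ≠ v → GA.finiteComponent W v' g = 1) ∧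
    ∀ w : InfinitePlace k, GA.infiniteComponent W w g = 1

/-- The elements supported at the finite place `v` form a subgroup (`G(k_v)` embedded at `v`). -/
def atFinitePlace (v : HeightOneSpectrum (𝓞 k)) : Subgroup (GA W) where
  carrier := {g | IsAtFinitePlace W v g}
  one_mem' := ⟨fun _ _ => map_one _, fun _ => map_one _⟩
  mul_mem' := by
    rintro g h ⟨hg1, hg2⟩ ⟨hh1, hh2⟩
    exact ⟨fun v' hv' => by rw [map_mul, hg1 v' hv', hh1 v' hv', one_mul],
      fun w => by rw [map_mul, hg2 w, hh2 w, one_mul]⟩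
  inv_mem' := by
    rintro g ⟨hg1, hg2⟩
    exact ⟨fun v' hv' => by rw [map_inv, hg1 v' hv', inv_one], fun w => by rw [map_inv, hg2 w, inv_one]⟩

/-- **The local torus at the finite place `v`**: `T(k_v) = U(W₀)_v × U(W₁)_v` embedded at `v`. -/
def localTorusAtFinite (v : HeightOneSpectrum (𝓞 k)) : Subgroup (GA W) := torusT W ⊓ atFinitePlace W v

/-- The local torus `T′(k_v)` at the finite place `v`. -/
def localTorusAtFinite' (v : HeightOneSpectrum (𝓞 k)) : Subgroup (GA W) := torusT' W ⊓ atFinitePlace W v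

/-- `T(k_v) ≤ T(𝔸_k)`. -/
theorem localTorusAtFinite_le (v : HeightOneSpectrum (𝓞 k)) : localTorusAtFinite W v ≤ torusT W := inf_le_left

/-- `T′(k_v) ≤ T′(𝔸_k)`. -/
theorem localTorusAtFinite'_le (v : HeightOneSpectrum (𝓞 k)) : localTorusAtFinite' W v ≤ torusT' W := inf_le_left

/-- **The local character**: the restriction of a character of `S` to a subgroup `S' ≤ S` (e.g. of `χ` on `T(𝔸_k)` to
`T(k_v)`). -/
def localChar {S S' : Subgroup (GA W)} (h : S' ≤ S) (χ : S → ℂ) : S' → ℂ := χ ∘ Subgroup.inclusion h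

/-- The local character of a character is a character. -/
theorem localChar_mul {S S' : Subgroup (GA W)} (h : S' ≤ S) (χ : S → ℂ) (hχ : ∀ s t : S, χ (s * t) = χ s * χ t)
    (s t : S') : localChar W h χ (s * t) = localChar W h χ s * localChar W h χ t := by
  simp only [localChar, Function.comp, map_mul, hχ]

end FinitePlace

section ToricFunctional

variable {k : Type} [Field k] [NumberField k] (W : PlaneData k)

/-- **A toric functional**: `ℓ ∈ Hom_S(V, χ)` — a linear functional on the functions of `G(𝔸_k)` transforming by `χ`
under the right translates by `S` of the elements of `V` (`ℓ (x ↦ f (x t)) = χ(t) ℓ(f)`); nothing is asked outside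
`V`. -/
def IsToricFunctional (S : Subgroup (GA W)) (χ : S → ℂ) (V : Submodule ℂ (GA W → ℂ))
    (ℓ : (GA W → ℂ) →ₗ[ℂ] ℂ) : Prop :=
  ∀ f ∈ V, ∀ t : S, ℓ (fun x => f (x * (t : GA W))) = χ t * ℓ f

/-- **`Hom_S(V, χ) ≠ 0`**: a toric functional not vanishing on `V` (with `S = localTorusAtFinite W v` the local
non-vanishing of Tunnell–Saito; with `S = torusT W` the global one). -/
def HasNonzeroToricFunctional (S : Subgroup (GA W)) (χ : S → ℂ) (V : Submodule ℂ (GA W → ℂ)) : Prop :=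
  ∃ ℓ : (GA W → ℂ) →ₗ[ℂ] ℂ, IsToricFunctional W S χ V ℓ ∧ ∃ f ∈ V, ℓ f ≠ 0

/-- A toric functional for `S` restricts to one for any `S' ≤ S` with the restricted character. -/
theorem IsToricFunctional.mono {S S' : Subgroup (GA W)} (h : S' ≤ S) {χ : S → ℂ} {V : Submodule ℂ (GA W → ℂ)}
    {ℓ : (GA W → ℂ) →ₗ[ℂ] ℂ} (hℓ : IsToricFunctional W S χ V ℓ) :
    IsToricFunctional W S' (localChar W h χ) V ℓ :=
  fun f hf t => hℓ f hf (Subgroup.inclusion h t)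

/-- Non-vanishing descends to subgroups. -/
theorem HasNonzeroToricFunctional.mono {S S' : Subgroup (GA W)} (h : S' ≤ S) {χ : S → ℂ}
    {V : Submodule ℂ (GA W → ℂ)} (hV : HasNonzeroToricFunctional W S χ V) :
    HasNonzeroToricFunctional W S' (localChar W h χ) V := by
  obtain ⟨ℓ, hℓ, f, hf, hne⟩ := hV
  exact ⟨ℓ, hℓ.mono W h, f, hf, hne⟩

end ToricFunctional

section SignData

variable (k : Type) [Field k] [NumberField k]

/-- **A sign datum**: a sign `±1` at every finite and every infinite place of `k`, `+1` at almost all finite places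
(the shape of a family of local root numbers / local theta-dichotomy signs).  Nothing ties the signs to any
character here — that tie is a PRINTED statement a line displays (W7 of the L4 wall census). -/
structure LocalSignData where
  /-- the sign at the finite place `v` -/
  epsFin : HeightOneSpectrum (𝓞 k) → ℤˣ
  /-- the sign at the infinite place `w` -/
  epsInf : InfinitePlace k → ℤˣ
  /-- almost all finite signs are `+1` -/
  finite_support : {v | epsFin v ≠ 1}.Finite

variable {k}

/-- **The global sign** `∏_v ε_v` (a finite product: the `finprod` over the finite places times the product over
the finitely many infinite places). -/
def LocalSignData.globalSign (D : LocalSignData k) : ℤˣ := (∏ᶠ v, D.epsFin v) * ∏ w, D.epsInf w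

/-- **The sign condition** `∏_v ε_v = +1`. -/
def LocalSignData.IsPlus (D : LocalSignData k) : Prop := D.globalSign = 1

/-- The trivial sign datum (`+1` everywhere). -/
def LocalSignData.trivial : LocalSignData k where
  epsFin := fun _ => 1
  epsInf := fun _ => 1
  finite_support := by simp

/-- The trivial sign datum satisfies the sign condition (the R4 witness of `IsPlus`). -/
theorem LocalSignData.trivial_isPlus : (LocalSignData.trivial : LocalSignData k).IsPlus := by
  simp [LocalSignData.IsPlus, LocalSignData.globalSign, LocalSignData.trivial]

end SignData

section Hecke

variable {k : Type} [Field k] [NumberField k] (W : PlaneData k)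

/-- **A Hecke test function**: a test function (continuous, compactly supported) bi-invariant under the subgroup `K`
(an open compact subgroup of the finite part and a maximal compact of the infinite part, in the lines' use). -/
def IsHeckeTestFn (K : Subgroup (GA W)) (f : GA W → ℂ) : Prop :=
  IsTestFn W f ∧ LeftInvariantUnder W K f ∧ RightInvariantUnder W K f

/-- **`R(f)` acts on `V` by the scalar `lam`** — the Hecke eigenvalue `λ_V(f)` of the right regular action
`rightRegular W μ f` (AdelicRTF) on the subspace `V`. -/
def IsHeckeEigenvalue [MeasurableSpace (GA W)] (μ : Measure (GA W)) (f : GA W → ℂ)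
    (V : Submodule ℂ (GA W → ℂ)) (lam : ℂ) : Prop :=
  ∀ φ ∈ V, rightRegular W μ f φ = fun x => lam * φ x

/-- The eigenvalue relation, pointwise. -/
theorem IsHeckeEigenvalue.apply [MeasurableSpace (GA W)] {μ : Measure (GA W)} {f : GA W → ℂ}
    {V : Submodule ℂ (GA W → ℂ)} {lam : ℂ} (h : IsHeckeEigenvalue W μ f V lam) {φ : GA W → ℂ} (hφ : φ ∈ V)
    (x : GA W) : rightRegular W μ f φ x = lam * φ x :=
  congrFun (h φ hφ) x

/-- On a non-zero `φ ∈ V` the eigenvalue is determined. -/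
theorem IsHeckeEigenvalue.unique [MeasurableSpace (GA W)] {μ : Measure (GA W)} {f : GA W → ℂ}
    {V : Submodule ℂ (GA W → ℂ)} {lam lam' : ℂ} (h : IsHeckeEigenvalue W μ f V lam)
    (h' : IsHeckeEigenvalue W μ f V lam') {φ : GA W → ℂ} (hφ : φ ∈ V) (hne : φ ≠ 0) : lam = lam' := by
  obtain ⟨x, hx⟩ := Function.ne_iff.1 hne
  have hx' : φ x ≠ 0 := by simpa using hx
  have := (h.apply W hφ x).symm.trans (h'.apply W hφ x)
  exact mul_right_cancel₀ hx' this

end Hecke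

/-! ## v0.2 (append): the finite part of `G(𝔸_k)` and its compact open subgroups (t4-plan-4 S13216 (3))

`finitePart W` = the elements of `G(𝔸_k)` whose component at EVERY infinite place is trivial — the image of
`G(𝔸_f)`; a subgroup `K ≤ finitePart W` that is compact and open IN the finite part (the subspace topology) is the
«compact open subgroup of `G(𝔸_f)`» of the `K`-fixed / `K`-finite vectors (`RightInvariantUnder W K f`, AdelicPlaces, is
«`f` is fixed by `K`»).  `G(𝔸_k)` itself has no compact open subgroups (its archimedean part is connected), which is
why the notion is stated relative to `finitePart W`. -/

section FinitePart

variable {k : Type} [Field k] [NumberField k] (W : PlaneData k)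

/-- `g ∈ G(𝔸_k)` lies in the finite part: its component at every infinite place is `1`. -/
def IsInFinitePart (g : GA W) : Prop := ∀ w : InfinitePlace k, GA.infiniteComponent W w g = 1

/-- **The finite part `G(𝔸_f) ≤ G(𝔸_k)`**: the elements with trivial archimedean components. -/
def finitePart : Subgroup (GA W) where
  carrier := {g | IsInFinitePart W g}
  one_mem' := fun _ => map_one _
  mul_mem' := by
    intro g h hg hh w
    rw [map_mul, hg w, hh w, one_mul]
  inv_mem' := by
    intro g hg w
    rw [map_inv, hg w, inv_one]

/-- Membership in the finite part, unfolded. -/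
theorem mem_finitePart (g : GA W) : g ∈ finitePart W ↔ ∀ w : InfinitePlace k, GA.infiniteComponent W w g = 1 :=
  Iff.rfl

/-- The elements supported at a finite place lie in the finite part. -/
theorem atFinitePlace_le_finitePart (v : HeightOneSpectrum (𝓞 k)) : atFinitePlace W v ≤ finitePart W :=
  fun _ hg => hg.2

/-- **`K` is a compact open subgroup of `S`** (for `S = finitePart W`: a compact open subgroup of `G(𝔸_f)`): `K ≤ S`,
`K` is compact, and `K` is open in the subspace topology of `S`. -/
def IsCompactOpenIn (S K : Subgroup (GA W)) : Prop :=
  K ≤ S ∧ IsCompact (K : Set (GA W)) ∧ IsOpen ((Subtype.val : S → GA W) ⁻¹' (K : Set (GA W)))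

/-- A compact open subgroup of `S` is contained in `S`. -/
theorem IsCompactOpenIn.le {S K : Subgroup (GA W)} (h : IsCompactOpenIn W S K) : K ≤ S := h.1

/-- A compact open subgroup of `S` is compact. -/
theorem IsCompactOpenIn.isCompact {S K : Subgroup (GA W)} (h : IsCompactOpenIn W S K) :
    IsCompact (K : Set (GA W)) := h.2.1

/-- A compact open subgroup of `S` is open in `S`. -/
theorem IsCompactOpenIn.isOpen {S K : Subgroup (GA W)} (h : IsCompactOpenIn W S K) :
    IsOpen ((Subtype.val : S → GA W) ⁻¹' (K : Set (GA W))) := h.2.2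

/-- **The `K`-fixed vectors of a subspace**: the `f ∈ V` with `f (x κ) = f x` for all `κ ∈ K` (`RightInvariantUnder`),
as a submodule. -/
def fixedBy (K : Subgroup (GA W)) (V : Submodule ℂ (GA W → ℂ)) : Submodule ℂ (GA W → ℂ) where
  carrier := {f | f ∈ V ∧ RightInvariantUnder W K f}
  zero_mem' := ⟨V.zero_mem, fun _ _ _ => rfl⟩
  add_mem' := by
    rintro f g ⟨hf, hf'⟩ ⟨hg, hg'⟩
    exact ⟨V.add_mem hf hg, fun x κ hκ => by simp only [Pi.add_apply, hf' x κ hκ, hg' x κ hκ]⟩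
  smul_mem' := by
    rintro c f ⟨hf, hf'⟩
    exact ⟨V.smul_mem c hf, fun x κ hκ => by simp only [Pi.smul_apply, hf' x κ hκ]⟩

/-- The fixed vectors form a subspace of `V`. -/
theorem fixedBy_le (K : Subgroup (GA W)) (V : Submodule ℂ (GA W → ℂ)) : fixedBy W K V ≤ V := fun _ hf => hf.1

/-- Membership in the fixed vectors. -/
theorem mem_fixedBy (K : Subgroup (GA W)) (V : Submodule ℂ (GA W → ℂ)) (f : GA W → ℂ) :
    f ∈ fixedBy W K V ↔ f ∈ V ∧ RightInvariantUnder W K f :=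
  Iff.rfl

end FinitePart

end Summit.Ventures.HodgeRepro.Tier4.Common

end
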